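import Literature.NumberTheory.Automorphic.ShimuraCurveRibetTakahashi
import Literature.NumberTheory.EllipticCurves.ManinConstantSemistablePrimewise
import Literature.NumberTheory.DiophantineGeometry.ConductorFactorizationProofs
import Literature.NumberTheory.DiophantineGeometry.ConductorExponentLeEightProofs
import HarnessLib

/-!
# Pasten 2024, Cor. 10.2 (`c_f ≤ 𝓜_S`): the printed deduction from Thm. 10.1 and the
# prime-by-prime results at `v_p(N) ≤ 1`, performed in the tree

Topic `NumberTheory/Automorphic`; a proofs-only companion (theorems only: no definitions, no named
facts) of `ShimuraCurveRibetTakahashi.lean`, for its named fact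
`Literature.NumberTheory.Automorphic.PastenShimura2024_cor_10_2` (H. Pasten, *Shimura curves and
the abc conjecture*, J. Number Theory 254 (2024) = arXiv:1705.09251, Cor. 10.2 p. 33 = Thm. 1.3
p. 4: for a finite set of primes `S` there is `𝓜_S` with `c_f ≤ 𝓜_S` for every optimal elliptic
curve over `ℚ` with semistable reduction away from `S`).

The source, §10.1 p. 33 (held arXiv text, read). Thm. 10.1: *"Let `S` be a finite set of primes
and let `p` be a prime number. There is a constant `μ_{S,p}` depending only on `S` and `p`, such
that for every optimal elliptic curve `A` over `ℚ` with semi-stable reduction outside `S` and with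
associated newform `f ∈ S₂(N)`, we have `v_p(c_f) ≤ μ_{S,p}`."* Then: *"The following is an
immediate consequence of the previous theorem and the known results about the Manin constant at
primes with `v_p(N) ≤ 1`. Corollary 10.2. …"*, the known results being (same page) *"After the
work of Mazur [MazurRatIsog] and Abbes, Ullmo, and Raynaud [AbbesUllmo] we know that if
`v_p(N) ≤ 1` then `v_p(c_f) = 0`, except, perhaps, for `p = 2` in which case the assumption
`v_2(N) ≤ 1` only gives `v_2(c_f) ≤ 1` … This last caveat at `p = 2` has been removed by recent
work of Cesnavicius, so that now one knows that for every prime `p` the following implication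
holds: `v_p(N) ≤ 1 ⇒ p ∤ c_f`."*

What this file proves (sorry-free, no new named fact, no statement of the tree changed):

* `abs_le_prod_pow_of_padicValInt_le` (with `padicValInt_le_natAbs`) — the arithmetic of the
  deduction: a non-zero integer whose `p`-adic valuation vanishes at the primes outside a finite
  set `T` of primes and is at most `μ p` at `p ∈ T` has absolute value at most `∏_{p ∈ T} p^{μ p}`;
* `PastenShimura2024_cor_10_2_iff_latticeForm` — **the fact is equivalent to its printed
  ("for every optimal elliptic curve") form** in the lattice language of the tree's
  Manin-constant series (`ModularCurveManinSemistable{…}Proofs`, `ManinConstantSemistablePrimewise`: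
  an *optimal* parametrisation is a datum `D'` on a globally minimal model `W'` with
  `Λ_{E'} ⊆ c Λ_f`, hence `c Λ_f = Λ_{E'}` and `|c| = c_f`): the fact's isogeny-free hypothesis
  (minimal degree among all data with the same newform) and `Λ_{E} ⊆ c Λ_f` define the same
  class of data, by the tree's `forall_modularDegree_le_of_latticeEq` and `exists_optimalDatum'`
  with `latticeEq_of_modularDegree_le`;
* `PastenShimura2024_cor_10_2_of_thm_10_1` — **Cor. 10.2 from Thm. 10.1 and the three
  prime-by-prime results, exactly as printed.** The inputs are: Thm. 10.1 at the primes of `S` in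
  the same lattice language ("semi-stable outside `S`" in the level form of Thm. 1.3,
  `q² ∣ N' ⇒ q ∈ S`), taken as an explicit hypothesis `h101` because Thm. 10.1 is not a
  declaration of the tree; and the tree's three named facts
  `mazur_not_dvd_maninConstant_of_odd` (Mazur 1978, Cor. 4.1: odd `p`, `p² ∤ N`),
  `abbesUllmo_not_dvd_maninConstant_of_not_dvd_level` (Abbes–Ullmo 1996, Thm. A: `p ∤ N`) and
  `cesnavicius_not_two_dvd_maninConstant_of_two_dvd_level` (Česnavičius 2018, Thm. 1.2: `2 ∥ N`);
  then `|c| = ∏ p^{v_p(c)} ≤ ∏_{p ∈ S} p^{μ_{S,p}} =: 𝓜_S`;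
* `PastenShimura2024_thm_10_1_latticeForm_of_cor_10_2` — conversely the fact gives back the
  hypothesis `h101` (indeed Thm. 10.1 in lattice form at every prime, with `μ = 𝓜_S`), since
  `v_p(c) < p^{v_p(c)} ≤ |c|`. So `h101` asks for nothing beyond the fact itself, and the open
  content of `PastenShimura2024_cor_10_2` is exactly {Thm. 10.1 at `p ∈ S`} together with the
  three prime-by-prime facts at `p ∉ S`;
* `PastenShimura2024_cor_10_2_of_thm_10_1_of_mazur` (with the monotonicity in `S`,
  `PastenShimura2024_cor_10_2_latticeForm_mono`) — **a shorter road: Thm. 10.1 and Mazur's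
  Cor. 4.1 alone suffice.** The statement for `S` follows from the statement for `S ∪ {2}`, whose
  outside primes are odd (Mazur) and whose prime `2` is covered by Thm. 10.1 itself (printed for
  every prime and every optimal curve semistable outside the set, whatever its reduction at `2`);
  so Abbes–Ullmo and Česnavičius are not on the path of the discharge, and modulo Mazur's fact the
  fact is *equivalent* to its Thm.-10.1 input (`PastenShimura2024_cor_10_2_iff_thm_10_1_latticeForm_of_mazur`).
* `PastenShimura2024_cor_10_2_of_thm_10_1_additive_of_mazur`,
  `PastenShimura2024_cor_10_2_of_thm_10_1_additive`,
  `PastenShimura2024_cor_10_2_iff_thm_10_1_additive_latticeForm` — **the new content of the paper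
  isolated from the classical inputs, following the printed proof of Thm. 10.1** (p. 33: "Theorem
  (ThmManinCt) will follow [from Thm. 10.3, levels `N = pⁿm`, `p ∤ m`, `n ≥ 2`] by fixing the
  choice `ℓ = 5` unless `p = 5` … and from the fact that `n ≤ 8` by (EqValN). The cases of
  semi-stable reduction at `p` (that is, `n = 0` or `1`) follow from the existing literature").
  So the only input that is not prior art is Thm. 10.1 for optimal curves *additive at `p`*
  (`p² ∣ N`, which forces `p ∈ S`; the union over `2 ≤ n ≤ 8` of Thm. 10.3): from it, Mazur's
  Cor. 4.1 and ANY bound for `v₂(c)` over optimal data at levels `N` with `4 ∤ N` (Abbes–Ullmo and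
  Česnavičius give the bound `0`) the fact follows, and modulo the three classical facts the fact
  is equivalent to this additive part alone.
* `PastenShimura2024_cor_10_2_holds_of`, `PastenShimura2024_thm_10_1_of_cor_10_2`,
  `PastenShimura2024_cor_10_2_iff_thm_10_1_of_mazur`, `PastenShimura2024_thm_10_1_latticeForm_of_additive`
  — **the discharge from exactly two inputs, Thm. 10.1 VERBATIM (every finite `S`, every prime `p`,
  lattice form) and Mazur's Cor. 4.1**, the converse, the equivalence modulo Mazur, and the printed
  first step of the proof of Thm. 10.1 (verbatim shape from the additive case and the classical
  facts). `PastenShimura2024_cor_10_2_holds_of` is the glue through which the fact is discharged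
  the day Thm. 10.1 (a theory of integral models of `X_{U₀(pⁿm) ∩ U₁(ℓ)}` and Néron models of
  Jacobians away) and Mazur's Cor. 4.1 are theorems of the tree.
* `factorization_level_le_eight`, `PastenShimura2024_thm_10_1_additive_of_thm_10_3`,
  `PastenShimura2024_thm_10_3_of_cor_10_2`, `PastenShimura2024_cor_10_2_of_thm_10_3`,
  `PastenShimura2024_cor_10_2_iff_thm_10_3` — **the second printed step: Thm. 10.1 (additive case)
  from Thm. 10.3, one exponent `n` at a time** (p. 34: "Theorem (ThmManinCt) will follow by fixing
  the choice `ℓ = 5` unless `p = 5` in which case we take `ℓ = 7`, and from the fact that `n ≤ 8`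
  by (EqValN)"). Thm. 10.3 enters as the hypothesis `h103` — for fixed `S`, `p` and `2 ≤ n ≤ 8` a
  bound for `v_p(c)` over optimal data at levels `N'` with `v_p(N') = n`, squarefree away from `S`
  (the auxiliary prime `ℓ` only affects the constant) — and (EqValN) `v_p(N') ≤ 8` is the tree's
  theorem `conductorExponent_le_eight_holds` (Brumer–Kramer; Silverman ATAEC IV.10.4) once the
  level is the conductor (Carayol, the named fact `IsNewformOf.level_eq_conductorNorm`, hypothesis
  `hCar`). Modulo Carayol's and the three prime-by-prime facts the fact is *equivalent* to `h103`,
  whose own commutative algebra (Pasten's valuation game, §§10.2, 10.4–10.6) is proved for abstract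
  modules in `ShimuraCurveRibetTakahashiManinValuationProofs.lean`.

Not attempted: Thm. 10.1 itself (Pasten §§10.2–10.6 pp. 33–37: the tower `X_{U₀(pⁿm) ∩ U₁(ℓ)}`,
its regular integral models, Néron models of `J` and `A`, `v(M)` for `ℤ_(p)`-modules) and the
three prime-by-prime facts (Néron models over `ℤ_(p)`, Deligne–Rapoport models, Raynaud's
theorems on finite flat group schemes) — none of that vocabulary exists in Mathlib or
`Literature/` yet; the discharge `PastenShimura2024_cor_10_2_holds` waits for them.

## References

* H. Pasten, *Shimura curves and the abc conjecture*, J. Number Theory 254 (2024) 214–335 =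
  arXiv:1705.09251: Thm. 1.3 p. 4, §10.1 p. 33 (Thm. 10.1, Cor. 10.2). [PastenShimura2024]
* B. Mazur, *Rational isogenies of prime degree*, Invent. Math. 44 (1978), Cor. 4.1. [Mazur1978]
* A. Abbes, E. Ullmo, *À propos de la conjecture de Manin pour les courbes elliptiques
  modulaires*, Compositio Math. 103 (1996), Thm. A. [AbbesUllmo1996]
* K. Česnavičius, *The Manin constant in the semistable case*, Compositio Math. 154 (2018),
  Thm. 1.2. [Cesnavicius2018]
* B. Edixhoven, *On the Manin constants of modular elliptic curves* (1991), Prop. 2 (`c_f ∈ ℤ`,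
  built into the datum). [EdixhovenManin1991]
-/

noncomputable section

open scoped MatrixGroups ModularForm

open CongruenceSubgroup UpperHalfPlane

namespace Literature.NumberTheory.Automorphic

open Literature.NumberTheory.EllipticCurves.ModularForms

/-! ### The arithmetic of the deduction -/

/-- **A non-zero integer with prescribed valuations is bounded.** If `c ≠ 0`, `T` is a finite set
of primes, `v_p(c) ≤ μ p` for `p ∈ T` and `p ∤ c` for every prime `p ∉ T`, then
`|c| ≤ ∏_{p ∈ T} p^{μ p}` — indeed `|c| = ∏_p p^{v_p(c)}` divides the right-hand side. [folklore] -/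
theorem abs_le_prod_pow_of_padicValInt_le {c : ℤ} (hc : c ≠ 0) {T : Finset ℕ}
    (hT : ∀ p ∈ T, p.Prime) (μ : ℕ → ℕ) (hin : ∀ p ∈ T, padicValInt p c ≤ μ p)
    (hout : ∀ p : ℕ, p.Prime → p ∉ T → ¬ (p : ℤ) ∣ c) :
    |c| ≤ ((∏ p ∈ T, p ^ μ p : ℕ) : ℤ) := by
  have hMpos : 0 < ∏ p ∈ T, p ^ μ p := Finset.prod_pos fun p hp ↦ pow_pos (hT p hp).pos _
  have hdvd : c.natAbs ∣ ∏ p ∈ T, p ^ μ p := by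
    refine (Nat.factorization_prime_le_iff_dvd (Int.natAbs_ne_zero.mpr hc) hMpos.ne').mp
      fun p hp ↦ ?_
    by_cases hpT : p ∈ T
    · calc c.natAbs.factorization p = padicValInt p c := by rw [Nat.factorization_def _ hp]; rfl
        _ ≤ μ p := hin p hpT
        _ = (p ^ μ p).factorization p := by rw [hp.factorization_pow, Finsupp.single_eq_same]
        _ ≤ (∏ q ∈ T, q ^ μ q).factorization p :=
          Finsupp.le_def.mp ((Nat.factorization_le_iff_dvd (pow_ne_zero _ hp.ne_zero)
            hMpos.ne').mpr (Finset.dvd_prod_of_mem (fun q ↦ q ^ μ q) hpT)) p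
    · rw [Nat.factorization_eq_zero_of_not_dvd fun h ↦ hout p hp hpT (Int.natCast_dvd.mpr h)]
      exact Nat.zero_le _
  calc |c| = (c.natAbs : ℤ) := Int.abs_eq_natAbs c
    _ ≤ ((∏ p ∈ T, p ^ μ p : ℕ) : ℤ) := by exact_mod_cast Nat.le_of_dvd hMpos hdvd

/-- **`v_p(c) ≤ |c|` for a non-zero integer `c` and a prime `p`** (`v_p(c) < p^{v_p(c)} ≤ |c|`).
[folklore] -/
theorem padicValInt_le_natAbs {c : ℤ} (hc : c ≠ 0) {p : ℕ} (hp : p.Prime) :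
    padicValInt p c ≤ c.natAbs := by
  have hdvd : p ^ padicValInt p c ∣ c.natAbs := by
    have h := padicValInt_dvd (p := p) c
    rw [← Int.natCast_pow] at h
    exact Int.natCast_dvd.mp h
  exact (Nat.lt_pow_self hp.one_lt).le.trans (Nat.le_of_dvd (Int.natAbs_pos.mpr hc) hdvd)

/-! ### The fact is its own lattice form: "optimal" = minimal degree -/

/-- **`PastenShimura2024_cor_10_2` is equivalent to its lattice (printed-optimality) form.** The
fact quantifies over data `Dt` of minimal degree among all data, of all elliptic `W'/ℚ`, with the
same newform at the same level (the tree's isogeny-free idiom for "`A` is the `X₀(N)`-optimal curve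
and `φ` its optimal parametrisation"); the printed Cor. 10.2 quantifies over optimal elliptic
curves. In the language of the tree's Manin-constant series the latter are the data `D'` on a
globally minimal model with `Λ_{E'} ⊆ c Λ_f` (then `c Λ_f = Λ_{E'}`, `φ_{D'}` is
`X₀(N') → ℂ/Λ_f = E_f` followed by `z ↦ cz`, and `|c| = c_f`). The two are the same class:
an optimal datum has minimal degree (`forall_modularDegree_le_of_latticeEq`; Knapp 1993,
Prop. 12.9 (a)), and a datum of minimal degree is optimal (`exists_optimalDatum'` with
`latticeEq_of_modularDegree_le`), both theorems of the tree.
[cite: PastenShimura2024, Cor. 10.2 p. 33 (= Thm. 1.3 p. 4)] -/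
theorem PastenShimura2024_cor_10_2_iff_latticeForm :
    PastenShimura2024_cor_10_2 ↔
    ∀ S : Finset ℕ, ∃ 𝓜 : ℕ, ∀ (W' : WeierstrassCurve ℚ) [W'.IsElliptic] [W'.IsGloballyMinimal]
      {N' : ℕ} [NeZero N'] (D' : ModularParametrizationData W' N'),
      (∀ z ∈ D'.L.lattice, ∃ w ∈ periodLattice D'.f, z = D'.c * w) →
      (∀ p : ℕ, p.Prime → p ∉ S → ¬ p ^ 2 ∣ N') → |D'.maninConstant| ≤ 𝓜 := by
  refine ⟨fun h S ↦ ?_, fun h S ↦ ?_⟩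
  · obtain ⟨𝓜, h𝓜⟩ := h S
    exact ⟨𝓜, fun W' _ _ N' _ D' hlat hsq ↦
      h𝓜 N' W' D' hsq (D'.forall_modularDegree_le_of_latticeEq hlat)⟩
  · obtain ⟨𝓜, h𝓜⟩ := h S
    refine ⟨𝓜, fun N _ W _ _ Dt hsq hmin ↦ ?_⟩
    -- a datum of minimal degree among all data with its newform is optimal: `Λ_E ⊆ c Λ_f`
    obtain ⟨W₀, hW₀, D₀, hf₀, h₀⟩ := Dt.exists_optimalDatum'
    haveI := hW₀
    exact h𝓜 W Dt (Dt.latticeEq_of_modularDegree_le D₀ hf₀ h₀ (hmin W₀ D₀ hf₀)) hsq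

/-! ### Cor. 10.2 from Thm. 10.1 and the prime-by-prime results -/

/-- **Pasten 2024, Cor. 10.2 from Thm. 10.1 and the known results at `v_p(N) ≤ 1` — the printed
proof (p. 33: "an immediate consequence of the previous theorem and the known results about the
Manin constant at primes with `v_p(N) ≤ 1`").** Inputs: (`h101`) Thm. 10.1 at the primes `p ∈ S`
in lattice form — for every globally minimal model `W'/ℚ`, every datum `D'` at level `N'` with
`Λ_{E'} ⊆ c Λ_f` (so `φ_{D'}` is the optimal parametrisation and `|c| = c_f`, Edixhoven's integer)
and `N'` squarefree away from `S` ("semi-stable reduction outside `S`", in the level form of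
Thm. 1.3), `v_p(c) ≤ μ_{S,p}` (at `p ∉ S` Thm. 10.1 is the classical `v_p(c_f) = 0` and is not
needed as a hypothesis); (`hM`, `hAU`, `hC`) the tree's named facts of Mazur 1978, Cor. 4.1 (odd
`p`, `p² ∤ N'`), Abbes–Ullmo 1996, Thm. A (`p ∤ N'`) and Česnavičius 2018, Thm. 1.2 (`2 ∥ N'`).
Proof, in the lattice form (`PastenShimura2024_cor_10_2_iff_latticeForm`): `c ≠ 0`
(`maninConstant_ne_zero_holds`); `p ∤ c` for primes `p ∉ S` since then `p² ∤ N'` (cases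
`p = 2 ∣ N'` / `p = 2 ∤ N'` / `p` odd); `v_p(c) ≤ μ_{S,p}` for `p ∈ S`; hence
`|c| ≤ 𝓜_S := ∏_{p ∈ S prime} p^{μ_{S,p}}` (`abs_le_prod_pow_of_padicValInt_le`).
[cite: PastenShimura2024, Cor. 10.2 p. 33 (proof: from Thm. 10.1 and the results at v_p(N) ≤ 1)] -/
theorem PastenShimura2024_cor_10_2_of_thm_10_1
    (h101 : ∀ (S : Finset ℕ), ∀ p ∈ S, p.Prime → ∃ μ : ℕ,
      ∀ (W' : WeierstrassCurve ℚ) [W'.IsElliptic] [W'.IsGloballyMinimal] {N' : ℕ} [NeZero N']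
        (D' : ModularParametrizationData W' N'),
        (∀ z ∈ D'.L.lattice, ∃ w ∈ periodLattice D'.f, z = D'.c * w) →
        (∀ q : ℕ, q.Prime → q ∉ S → ¬ q ^ 2 ∣ N') →
        padicValInt p D'.maninConstant ≤ μ)
    (hM : mazur_not_dvd_maninConstant_of_odd)
    (hAU : abbesUllmo_not_dvd_maninConstant_of_not_dvd_level)
    (hC : cesnavicius_not_two_dvd_maninConstant_of_two_dvd_level) :
    PastenShimura2024_cor_10_2 := by
  refine PastenShimura2024_cor_10_2_iff_latticeForm.mpr fun S ↦ ?_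
  classical
  choose! μ hμ using h101 S
  refine ⟨∏ p ∈ S.filter Nat.Prime, p ^ μ p, fun W' _ _ N' _ D' hlat hsq ↦ ?_⟩
  refine abs_le_prod_pow_of_padicValInt_le D'.maninConstant_ne_zero_holds
    (fun p hp ↦ (Finset.mem_filter.mp hp).2) μ (fun p hp ↦ ?_) (fun p hp hpT ↦ ?_)
  · -- `p ∈ S`: Thm. 10.1
    obtain ⟨hpS, hpp⟩ := Finset.mem_filter.mp hp
    exact hμ p hpS hpp W' D' hlat hsq
  · -- `p ∉ S`: `p² ∤ N'`, so `p ∤ c` by Mazur / Abbes–Ullmo / Česnavičius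
    have hp2 : ¬ p ^ 2 ∣ N' := hsq p hp fun h ↦ hpT (Finset.mem_filter.mpr ⟨h, hp⟩)
    by_cases h2 : p = 2
    · subst h2
      by_cases hdvd : 2 ∣ N'
      · exact hC W' D' hlat hdvd hp2
      · exact hAU W' D' hlat 2 hp hdvd
    · exact hM W' D' hlat p hp h2 hp2

/-! ### Conversely: the fact gives back Thm. 10.1 in lattice form -/

/-- **The fact implies its Thm.-10.1-type input** (so the hypothesis `h101` of
`PastenShimura2024_cor_10_2_of_thm_10_1` asks for nothing beyond the fact): if
`PastenShimura2024_cor_10_2` holds then for every finite `S` there is one `μ` (namely `𝓜_S`) with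
`v_p(c) ≤ μ` for every prime `p`, every globally minimal `W'/ℚ` and every optimal datum `D'`
(`Λ_{E'} ⊆ c Λ_f`) at a level squarefree away from `S`: by the lattice form of the fact
`|c| ≤ 𝓜_S`, and `v_p(c) ≤ |c|`. This is Thm. 10.1 in lattice form, with `μ` uniform in `p`,
read off from Cor. 10.2. [cite: PastenShimura2024, Thm. 10.1 and Cor. 10.2 p. 33] -/
theorem PastenShimura2024_thm_10_1_latticeForm_of_cor_10_2 (h : PastenShimura2024_cor_10_2)
    (S : Finset ℕ) : ∃ μ : ℕ, ∀ p : ℕ, p.Prime →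
      ∀ (W' : WeierstrassCurve ℚ) [W'.IsElliptic] [W'.IsGloballyMinimal] {N' : ℕ} [NeZero N']
        (D' : ModularParametrizationData W' N'),
        (∀ z ∈ D'.L.lattice, ∃ w ∈ periodLattice D'.f, z = D'.c * w) →
        (∀ q : ℕ, q.Prime → q ∉ S → ¬ q ^ 2 ∣ N') →
        padicValInt p D'.maninConstant ≤ μ := by
  obtain ⟨𝓜, h𝓜⟩ := PastenShimura2024_cor_10_2_iff_latticeForm.mp h S
  refine ⟨𝓜, fun p hp W' _ _ N' _ D' hlat hsq ↦ ?_⟩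
  have h1 : (padicValInt p D'.maninConstant : ℤ) ≤ (D'.maninConstant.natAbs : ℤ) := by
    exact_mod_cast padicValInt_le_natAbs D'.maninConstant_ne_zero_holds hp
  rw [Int.natCast_natAbs] at h1
  exact_mod_cast h1.trans (h𝓜 W' D' hlat hsq)

/-! ### Enlarging `S`: at the primes outside `S` only Mazur's Cor. 4.1 is needed -/

/-- **The lattice form is monotone in `S`.** If the bound holds for all optimal data at levels
squarefree away from `T` and `S ⊆ T`, it holds (with the same `𝓜`) at levels squarefree away
from `S`: a level squarefree away from `S` is squarefree away from `T`. [folklore] -/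
theorem PastenShimura2024_cor_10_2_latticeForm_mono {S T : Finset ℕ} (hST : S ⊆ T) {𝓜 : ℕ}
    (h : ∀ (W' : WeierstrassCurve ℚ) [W'.IsElliptic] [W'.IsGloballyMinimal]
      {N' : ℕ} [NeZero N'] (D' : ModularParametrizationData W' N'),
      (∀ z ∈ D'.L.lattice, ∃ w ∈ periodLattice D'.f, z = D'.c * w) →
      (∀ p : ℕ, p.Prime → p ∉ T → ¬ p ^ 2 ∣ N') → |D'.maninConstant| ≤ 𝓜)
    (W' : WeierstrassCurve ℚ) [W'.IsElliptic] [W'.IsGloballyMinimal]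
    {N' : ℕ} [NeZero N'] (D' : ModularParametrizationData W' N')
    (hlat : ∀ z ∈ D'.L.lattice, ∃ w ∈ periodLattice D'.f, z = D'.c * w)
    (hsq : ∀ p : ℕ, p.Prime → p ∉ S → ¬ p ^ 2 ∣ N') : |D'.maninConstant| ≤ 𝓜 :=
  h W' D' hlat fun p hp hpT ↦ hsq p hp fun hpS ↦ hpT (hST hpS)

/-- **Cor. 10.2 from Thm. 10.1 (at the primes of `S ∪ {2}`) and Mazur's Cor. 4.1 alone.** The
printed proof (p. 33) quotes the results at `v_p(N) ≤ 1` for every prime `p ∉ S`: Mazur (odd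
`p`), Abbes–Ullmo (`2 ∤ N`) and Česnavičius (`2 ∥ N`), as in
`PastenShimura2024_cor_10_2_of_thm_10_1`. The last two are dispensable as separate inputs — a
shorter road than the printed one, recorded so that the discharge of the fact needs two inputs
(Thm. 10.1, Mazur's Cor. 4.1) rather than four: the statement for `S` follows from the statement
for `T = S ∪ {2}` (`PastenShimura2024_cor_10_2_latticeForm_mono`; `𝓜_{S ∪ {2}}` serves as `𝓜_S`),
every prime outside `T` is odd and has `p² ∤ N'`, where Mazur's Cor. 4.1 gives `p ∤ c`, and the
prime `2 ∈ T` is covered by Thm. 10.1 itself — printed for *every* prime `p` and every optimal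
curve semistable outside the given set (here `T`), whatever its reduction at `2`. The hypothesis
`h101` is the same as in `PastenShimura2024_cor_10_2_of_thm_10_1` (Thm. 10.1 in lattice form at
the primes of the set; it is used at `T` only) and is implied back by the fact
(`PastenShimura2024_thm_10_1_latticeForm_of_cor_10_2`).
[cite: PastenShimura2024, Thm. 10.1 and Cor. 10.2 p. 33] [cite: Mazur1978, Cor. 4.1] -/
theorem PastenShimura2024_cor_10_2_of_thm_10_1_of_mazur
    (h101 : ∀ (S : Finset ℕ), ∀ p ∈ S, p.Prime → ∃ μ : ℕ,
      ∀ (W' : WeierstrassCurve ℚ) [W'.IsElliptic] [W'.IsGloballyMinimal] {N' : ℕ} [NeZero N']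
        (D' : ModularParametrizationData W' N'),
        (∀ z ∈ D'.L.lattice, ∃ w ∈ periodLattice D'.f, z = D'.c * w) →
        (∀ q : ℕ, q.Prime → q ∉ S → ¬ q ^ 2 ∣ N') →
        padicValInt p D'.maninConstant ≤ μ)
    (hM : mazur_not_dvd_maninConstant_of_odd) :
    PastenShimura2024_cor_10_2 := by
  refine PastenShimura2024_cor_10_2_iff_latticeForm.mpr fun S ↦ ?_
  classical
  -- the bound for `T = S ∪ {2}` serves for `S`
  choose! μ hμ using h101 (insert 2 S)
  refine ⟨∏ p ∈ (insert 2 S).filter Nat.Prime, p ^ μ p,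
    PastenShimura2024_cor_10_2_latticeForm_mono (S.subset_insert 2)
      fun W' _ _ N' _ D' hlat hsq ↦ ?_⟩
  refine abs_le_prod_pow_of_padicValInt_le D'.maninConstant_ne_zero_holds
    (fun p hp ↦ (Finset.mem_filter.mp hp).2) μ (fun p hp ↦ ?_) (fun p hp hpT ↦ ?_)
  · -- `p ∈ S ∪ {2}`: Thm. 10.1 (at `p = 2` whatever the reduction of the curve at `2`)
    obtain ⟨hpS, hpp⟩ := Finset.mem_filter.mp hp
    exact hμ p hpS hpp W' D' hlat hsq
  · -- `p ∉ S ∪ {2}`: `p` is odd and `p² ∤ N'`, so `p ∤ c` by Mazur's Cor. 4.1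
    have hpT' : p ∉ insert 2 S := fun h ↦ hpT (Finset.mem_filter.mpr ⟨h, hp⟩)
    exact hM W' D' hlat p hp (fun h2 ↦ hpT' (h2 ▸ Finset.mem_insert_self 2 S)) (hsq p hp hpT')

/-- **Modulo Mazur's Cor. 4.1 alone, the fact is equivalent to its Thm.-10.1 input** (lattice
form, at the primes of each finite set): `PastenShimura2024_cor_10_2_of_thm_10_1_of_mazur` one
way, `PastenShimura2024_thm_10_1_latticeForm_of_cor_10_2` the other (which needs no input at all).
So, once `mazur_not_dvd_maninConstant_of_odd` is discharged, the open content of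
`PastenShimura2024_cor_10_2` is exactly Pasten's Thm. 10.1 at the primes of `S`; the facts of
Abbes–Ullmo and Česnavičius at `p = 2` are not on its path.
[cite: PastenShimura2024, Thm. 10.1 and Cor. 10.2 p. 33] [cite: Mazur1978, Cor. 4.1] -/
theorem PastenShimura2024_cor_10_2_iff_thm_10_1_latticeForm_of_mazur
    (hM : mazur_not_dvd_maninConstant_of_odd) :
    PastenShimura2024_cor_10_2 ↔
    ∀ (S : Finset ℕ), ∀ p ∈ S, p.Prime → ∃ μ : ℕ,
      ∀ (W' : WeierstrassCurve ℚ) [W'.IsElliptic] [W'.IsGloballyMinimal] {N' : ℕ} [NeZero N']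
        (D' : ModularParametrizationData W' N'),
        (∀ z ∈ D'.L.lattice, ∃ w ∈ periodLattice D'.f, z = D'.c * w) →
        (∀ q : ℕ, q.Prime → q ∉ S → ¬ q ^ 2 ∣ N') →
        padicValInt p D'.maninConstant ≤ μ :=
  ⟨fun h S p _ hp ↦
    (PastenShimura2024_thm_10_1_latticeForm_of_cor_10_2 h S).imp fun _ hμ W' _ _ _ _ D' ↦
      hμ p hp W' D',
    fun h101 ↦ PastenShimura2024_cor_10_2_of_thm_10_1_of_mazur h101 hM⟩

/-! ### The new content isolated: Thm. 10.1 for optimal curves additive at `p` -/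

/-- **Cor. 10.2 from Thm. 10.1 in the additive case, Mazur's Cor. 4.1 and a `2`-adic bound at
`v₂(N) ≤ 1`.** The printed proof of Thm. 10.1 (p. 33) proves the new bound only for optimal
curves of conductor `N = pⁿm` with `p ∤ m` and `n ≥ 2` (Thm. 10.3, "our assumption `n ≥ 2`
force[s] `p ∈ S`"; then `n ≤ 8` by (EqValN)) and adds: "The cases of semi-stable reduction at `p`
(that is, `n = 0` or `1`) follow from the existing literature." Accordingly the inputs here are:
(`hadd`) Thm. 10.1 in lattice form for optimal data whose level is divisible by `p²` and
squarefree away from `S` — the union over `2 ≤ n ≤ 8` of Thm. 10.3, the only statement of §10 that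
is not prior art (no hypothesis `p ∈ S` is written: if `p ∉ S` the two level conditions are
contradictory); (`hM`) Mazur's Cor. 4.1 (odd `p`, `p² ∤ N`: `p ∤ c`); (`h2`) SOME bound `B` for
`v₂(c)` over optimal data at levels `N` with `4 ∤ N` (classically `v₂(c_f) ≤ 1`, Mazur and
Abbes–Ullmo–Raynaud, as quoted on p. 33; `B = 0` by Abbes–Ullmo and Česnavičius,
`PastenShimura2024_cor_10_2_of_thm_10_1_additive`). Proof: these give the hypothesis `h101` of
`PastenShimura2024_cor_10_2_of_thm_10_1_of_mazur` with `μ_{S,p} = max(μ^{add}_{S,p}, B)`: at a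
level with `p² ∣ N'` use `hadd`; otherwise `v_p(c) = 0` for odd `p` (Mazur) and `v₂(c) ≤ B`.
[cite: PastenShimura2024, Thm. 10.1, Cor. 10.2 and Thm. 10.3 p. 33 (reduction of Thm. 10.1 to n ≥ 2)] [cite: Mazur1978, Cor. 4.1] -/
theorem PastenShimura2024_cor_10_2_of_thm_10_1_additive_of_mazur
    (hadd : ∀ (S : Finset ℕ) (p : ℕ), p.Prime → ∃ μ : ℕ,
      ∀ (W' : WeierstrassCurve ℚ) [W'.IsElliptic] [W'.IsGloballyMinimal] {N' : ℕ} [NeZero N']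
        (D' : ModularParametrizationData W' N'),
        (∀ z ∈ D'.L.lattice, ∃ w ∈ periodLattice D'.f, z = D'.c * w) →
        p ^ 2 ∣ N' → (∀ q : ℕ, q.Prime → q ∉ S → ¬ q ^ 2 ∣ N') →
        padicValInt p D'.maninConstant ≤ μ)
    (hM : mazur_not_dvd_maninConstant_of_odd)
    (h2 : ∃ B : ℕ, ∀ (W' : WeierstrassCurve ℚ) [W'.IsElliptic] [W'.IsGloballyMinimal]
        {N' : ℕ} [NeZero N'] (D' : ModularParametrizationData W' N'),
        (∀ z ∈ D'.L.lattice, ∃ w ∈ periodLattice D'.f, z = D'.c * w) →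
        ¬ 2 ^ 2 ∣ N' → padicValInt 2 D'.maninConstant ≤ B) :
    PastenShimura2024_cor_10_2 := by
  refine PastenShimura2024_cor_10_2_of_thm_10_1_of_mazur (fun S p _ hp ↦ ?_) hM
  -- Thm. 10.1 at `p`: the additive case is `hadd`; the semistable case is prior art
  obtain ⟨μ, hμ⟩ := hadd S p hp
  obtain ⟨B, hB⟩ := h2
  refine ⟨max μ B, fun W' _ _ N' _ D' hlat hsq ↦ ?_⟩
  by_cases hpN : p ^ 2 ∣ N'
  · exact (hμ W' D' hlat hpN hsq).trans (le_max_left μ B)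
  · by_cases hp2 : p = 2
    · subst hp2
      exact (hB W' D' hlat hpN).trans (le_max_right μ B)
    · rw [padicValInt.eq_zero_of_not_dvd (hM W' D' hlat p hp hp2 hpN)]
      exact Nat.zero_le _

/-- **Cor. 10.2 from Thm. 10.1 in the additive case and the three classical prime-by-prime
facts** (Mazur 1978, Cor. 4.1; Abbes–Ullmo 1996, Thm. A; Česnavičius 2018, Thm. 1.2): the `2`-adic
input `h2` of `PastenShimura2024_cor_10_2_of_thm_10_1_additive_of_mazur` holds with `B = 0`, since
at a level `N'` with `4 ∤ N'` either `2 ∤ N'` (Abbes–Ullmo) or `2 ∥ N'` (Česnavičius). This is the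
printed proof of Cor. 10.2 with Thm. 10.1 opened up one step (p. 33): new content (`n ≥ 2`) plus
"existing literature" (`n ≤ 1`).
[cite: PastenShimura2024, Thm. 10.1, Cor. 10.2 and Thm. 10.3 p. 33] [cite: Mazur1978, Cor. 4.1] [cite: AbbesUllmo1996, Thm. A] [cite: Cesnavicius2018, Thm. 1.2] -/
theorem PastenShimura2024_cor_10_2_of_thm_10_1_additive
    (hadd : ∀ (S : Finset ℕ) (p : ℕ), p.Prime → ∃ μ : ℕ,
      ∀ (W' : WeierstrassCurve ℚ) [W'.IsElliptic] [W'.IsGloballyMinimal] {N' : ℕ} [NeZero N']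
        (D' : ModularParametrizationData W' N'),
        (∀ z ∈ D'.L.lattice, ∃ w ∈ periodLattice D'.f, z = D'.c * w) →
        p ^ 2 ∣ N' → (∀ q : ℕ, q.Prime → q ∉ S → ¬ q ^ 2 ∣ N') →
        padicValInt p D'.maninConstant ≤ μ)
    (hM : mazur_not_dvd_maninConstant_of_odd)
    (hAU : abbesUllmo_not_dvd_maninConstant_of_not_dvd_level)
    (hC : cesnavicius_not_two_dvd_maninConstant_of_two_dvd_level) :
    PastenShimura2024_cor_10_2 := by
  refine PastenShimura2024_cor_10_2_of_thm_10_1_additive_of_mazur hadd hM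
    ⟨0, fun W' _ _ N' _ D' hlat h4 ↦ ?_⟩
  have h2c : ¬ (2 : ℤ) ∣ D'.maninConstant := by
    by_cases hdvd : 2 ∣ N'
    · exact hC W' D' hlat hdvd h4
    · exact hAU W' D' hlat 2 Nat.prime_two hdvd
  rw [padicValInt.eq_zero_of_not_dvd (by exact_mod_cast h2c)]

/-- **The fact gives back its additive-case input** (a restriction of
`PastenShimura2024_thm_10_1_latticeForm_of_cor_10_2`: the bound `𝓜_S` serves at every prime, in
particular at levels divisible by `p²`). [cite: PastenShimura2024, Thm. 10.1 and Cor. 10.2 p. 33] -/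
theorem PastenShimura2024_thm_10_1_additive_latticeForm_of_cor_10_2
    (h : PastenShimura2024_cor_10_2) (S : Finset ℕ) (p : ℕ) (hp : p.Prime) : ∃ μ : ℕ,
      ∀ (W' : WeierstrassCurve ℚ) [W'.IsElliptic] [W'.IsGloballyMinimal] {N' : ℕ} [NeZero N']
        (D' : ModularParametrizationData W' N'),
        (∀ z ∈ D'.L.lattice, ∃ w ∈ periodLattice D'.f, z = D'.c * w) →
        p ^ 2 ∣ N' → (∀ q : ℕ, q.Prime → q ∉ S → ¬ q ^ 2 ∣ N') →
        padicValInt p D'.maninConstant ≤ μ :=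
  (PastenShimura2024_thm_10_1_latticeForm_of_cor_10_2 h S).imp fun _ hμ W' _ _ _ _ D' hlat _ ↦
    hμ p hp W' D' hlat

/-- **Modulo the three classical facts, `PastenShimura2024_cor_10_2` is equivalent to Thm. 10.1
for optimal curves additive at `p`** — the union over `2 ≤ n ≤ 8` of Pasten's Thm. 10.3, i.e. the
part of §10 proved by the tower `X_{U₀(pⁿm) ∩ U₁(ℓ)}` (§§10.2–10.6), and nothing else: once
Mazur's Cor. 4.1, Abbes–Ullmo's Thm. A and Česnavičius's Thm. 1.2 are discharged, this is exactly
the open content of the fact. [cite: PastenShimura2024, Thm. 10.1, Cor. 10.2 and Thm. 10.3 p. 33] -/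
theorem PastenShimura2024_cor_10_2_iff_thm_10_1_additive_latticeForm
    (hM : mazur_not_dvd_maninConstant_of_odd)
    (hAU : abbesUllmo_not_dvd_maninConstant_of_not_dvd_level)
    (hC : cesnavicius_not_two_dvd_maninConstant_of_two_dvd_level) :
    PastenShimura2024_cor_10_2 ↔
    ∀ (S : Finset ℕ) (p : ℕ), p.Prime → ∃ μ : ℕ,
      ∀ (W' : WeierstrassCurve ℚ) [W'.IsElliptic] [W'.IsGloballyMinimal] {N' : ℕ} [NeZero N']
        (D' : ModularParametrizationData W' N'),
        (∀ z ∈ D'.L.lattice, ∃ w ∈ periodLattice D'.f, z = D'.c * w) →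
        p ^ 2 ∣ N' → (∀ q : ℕ, q.Prime → q ∉ S → ¬ q ^ 2 ∣ N') →
        padicValInt p D'.maninConstant ≤ μ :=
  ⟨PastenShimura2024_thm_10_1_additive_latticeForm_of_cor_10_2,
    fun hadd ↦ PastenShimura2024_cor_10_2_of_thm_10_1_additive hadd hM hAU hC⟩

/-! ### The discharge from two inputs: Thm. 10.1 verbatim and Mazur's Cor. 4.1 -/

/-- **`PastenShimura2024_cor_10_2` from its two sources: Pasten's Thm. 10.1 AS PRINTED and Mazur's
Cor. 4.1.** The first input `h101` is Thm. 10.1 verbatim in lattice form — for EVERY finite set of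
primes `S` and EVERY prime `p` (p. 33: "Let `S` be a finite set of primes and let `p` be a prime
number. There is a constant `μ_{S,p}` … such that for every optimal elliptic curve `A` over `ℚ` with
semi-stable reduction outside `S` and with associated newform `f ∈ S₂(N)`, we have
`v_p(c_f) ≤ μ_{S,p}`"), over optimal data `D'` (`Λ_{E'} ⊆ c Λ_f`) on globally minimal models at
levels squarefree away from `S` — with no restriction `p ∈ S` on the prime (the shape of
`PastenShimura2024_cor_10_2_of_thm_10_1_of_mazur` restricts to `p ∈ S`, which is all that is used);
the second is the tree's named fact `mazur_not_dvd_maninConstant_of_odd` (Mazur 1978, Cor. 4.1).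
This is the printed proof of Cor. 10.2 ("an immediate consequence of the previous theorem and the
known results about the Manin constant at primes with `v_p(N) ≤ 1`") run at `S ∪ {2}`, where the
only known result needed is Mazur's (`PastenShimura2024_cor_10_2_of_thm_10_1_of_mazur`). Conversely
the fact returns `h101` with `μ = 𝓜_S` (`PastenShimura2024_thm_10_1_of_cor_10_2`), so modulo
Mazur's Cor. 4.1 the fact and Thm. 10.1 (lattice form) are equivalent
(`PastenShimura2024_cor_10_2_iff_thm_10_1_of_mazur`).
[cite: PastenShimura2024, Thm. 10.1 and Cor. 10.2 p. 33] [cite: Mazur1978, Cor. 4.1] -/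
theorem PastenShimura2024_cor_10_2_holds_of
    (h101 : ∀ (S : Finset ℕ) (p : ℕ), p.Prime → ∃ μ : ℕ,
      ∀ (W' : WeierstrassCurve ℚ) [W'.IsElliptic] [W'.IsGloballyMinimal] {N' : ℕ} [NeZero N']
        (D' : ModularParametrizationData W' N'),
        (∀ z ∈ D'.L.lattice, ∃ w ∈ periodLattice D'.f, z = D'.c * w) →
        (∀ q : ℕ, q.Prime → q ∉ S → ¬ q ^ 2 ∣ N') →
        padicValInt p D'.maninConstant ≤ μ)
    (hM : mazur_not_dvd_maninConstant_of_odd) :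
    PastenShimura2024_cor_10_2 :=
  PastenShimura2024_cor_10_2_of_thm_10_1_of_mazur (fun S p _ hp ↦ h101 S p hp) hM

/-- **The fact gives back Thm. 10.1 verbatim (lattice form): for every finite `S` and every prime
`p`, `v_p(c) ≤ 𝓜_S`** for optimal data at levels squarefree away from `S` — the hypothesis `h101`
of `PastenShimura2024_cor_10_2_holds_of`, read off from Cor. 10.2 by `v_p(c) ≤ |c|`
(`PastenShimura2024_thm_10_1_latticeForm_of_cor_10_2`, whose `μ` is even uniform in `p`).
[cite: PastenShimura2024, Thm. 10.1 and Cor. 10.2 p. 33] -/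
theorem PastenShimura2024_thm_10_1_of_cor_10_2 (h : PastenShimura2024_cor_10_2) (S : Finset ℕ)
    (p : ℕ) (hp : p.Prime) : ∃ μ : ℕ,
      ∀ (W' : WeierstrassCurve ℚ) [W'.IsElliptic] [W'.IsGloballyMinimal] {N' : ℕ} [NeZero N']
        (D' : ModularParametrizationData W' N'),
        (∀ z ∈ D'.L.lattice, ∃ w ∈ periodLattice D'.f, z = D'.c * w) →
        (∀ q : ℕ, q.Prime → q ∉ S → ¬ q ^ 2 ∣ N') →
        padicValInt p D'.maninConstant ≤ μ :=
  (PastenShimura2024_thm_10_1_latticeForm_of_cor_10_2 h S).imp fun _ hμ W' _ _ _ _ D' ↦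
    hμ p hp W' D'

/-- **Modulo Mazur's Cor. 4.1, `PastenShimura2024_cor_10_2` is equivalent to Pasten's Thm. 10.1
verbatim** (lattice form, every finite `S` and every prime `p`): the two directions are
`PastenShimura2024_thm_10_1_of_cor_10_2` (unconditional) and `PastenShimura2024_cor_10_2_holds_of`.
So the discharge of the fact needs exactly two inputs, the printed Thm. 10.1 (proof: Thm. 10.3 for
`2 ≤ n ≤ 8` via the tower `X_{U₀(pⁿm) ∩ U₁(ℓ)}`, §§10.2–10.6, plus the classical cases `n ≤ 1`)
and Mazur's Cor. 4.1 at the odd primes outside `S ∪ {2}`.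
[cite: PastenShimura2024, Thm. 10.1 and Cor. 10.2 p. 33] [cite: Mazur1978, Cor. 4.1] -/
theorem PastenShimura2024_cor_10_2_iff_thm_10_1_of_mazur
    (hM : mazur_not_dvd_maninConstant_of_odd) :
    PastenShimura2024_cor_10_2 ↔
    ∀ (S : Finset ℕ) (p : ℕ), p.Prime → ∃ μ : ℕ,
      ∀ (W' : WeierstrassCurve ℚ) [W'.IsElliptic] [W'.IsGloballyMinimal] {N' : ℕ} [NeZero N']
        (D' : ModularParametrizationData W' N'),
        (∀ z ∈ D'.L.lattice, ∃ w ∈ periodLattice D'.f, z = D'.c * w) →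
        (∀ q : ℕ, q.Prime → q ∉ S → ¬ q ^ 2 ∣ N') →
        padicValInt p D'.maninConstant ≤ μ :=
  ⟨PastenShimura2024_thm_10_1_of_cor_10_2, fun h101 ↦ PastenShimura2024_cor_10_2_holds_of h101 hM⟩

/-- **Thm. 10.1 verbatim (lattice form) from its additive case and the three classical facts** —
the first step of the printed proof of Thm. 10.1 (p. 33: Thm. 10.3 for `n ≥ 2`, "the cases of
semi-stable reduction at `p` (that is, `n = 0` or `1`) follow from the existing literature"),
performed on the hypothesis shapes of this file: at a level with `p² ∣ N'` use the additive-case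
bound; at a level with `p² ∤ N'`, `p ∤ c` by Mazur (odd `p`), Abbes–Ullmo (`2 ∤ N'`) or Česnavičius
(`2 ∥ N'`), so `v_p(c) = 0`. Hence the input `h101` of `PastenShimura2024_cor_10_2_holds_of` is,
modulo the classical facts, the additive case alone (cf.
`PastenShimura2024_cor_10_2_iff_thm_10_1_additive_latticeForm`).
[cite: PastenShimura2024, Thm. 10.1 and Thm. 10.3 p. 33] [cite: Mazur1978, Cor. 4.1] [cite: AbbesUllmo1996, Thm. A] [cite: Cesnavicius2018, Thm. 1.2] -/
theorem PastenShimura2024_thm_10_1_latticeForm_of_additive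
    (hadd : ∀ (S : Finset ℕ) (p : ℕ), p.Prime → ∃ μ : ℕ,
      ∀ (W' : WeierstrassCurve ℚ) [W'.IsElliptic] [W'.IsGloballyMinimal] {N' : ℕ} [NeZero N']
        (D' : ModularParametrizationData W' N'),
        (∀ z ∈ D'.L.lattice, ∃ w ∈ periodLattice D'.f, z = D'.c * w) →
        p ^ 2 ∣ N' → (∀ q : ℕ, q.Prime → q ∉ S → ¬ q ^ 2 ∣ N') →
        padicValInt p D'.maninConstant ≤ μ)
    (hM : mazur_not_dvd_maninConstant_of_odd)
    (hAU : abbesUllmo_not_dvd_maninConstant_of_not_dvd_level)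
    (hC : cesnavicius_not_two_dvd_maninConstant_of_two_dvd_level)
    (S : Finset ℕ) (p : ℕ) (hp : p.Prime) : ∃ μ : ℕ,
      ∀ (W' : WeierstrassCurve ℚ) [W'.IsElliptic] [W'.IsGloballyMinimal] {N' : ℕ} [NeZero N']
        (D' : ModularParametrizationData W' N'),
        (∀ z ∈ D'.L.lattice, ∃ w ∈ periodLattice D'.f, z = D'.c * w) →
        (∀ q : ℕ, q.Prime → q ∉ S → ¬ q ^ 2 ∣ N') →
        padicValInt p D'.maninConstant ≤ μ := by
  obtain ⟨μ, hμ⟩ := hadd S p hp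
  refine ⟨μ, fun W' _ _ N' _ D' hlat hsq ↦ ?_⟩
  by_cases hpN : p ^ 2 ∣ N'
  · -- additive reduction at `p` (`n ≥ 2`): the new content, Thm. 10.3
    exact hμ W' D' hlat hpN hsq
  · -- semi-stable reduction at `p` (`n ≤ 1`): `p ∤ c` by the existing literature
    have hndvd : ¬ (p : ℤ) ∣ D'.maninConstant := by
      by_cases h2 : p = 2
      · subst h2
        by_cases hdvd : 2 ∣ N'
        · exact_mod_cast hC W' D' hlat hdvd hpN
        · exact_mod_cast hAU W' D' hlat 2 hp hdvd
      · exact hM W' D' hlat p hp h2 hpN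
    rw [padicValInt.eq_zero_of_not_dvd hndvd]
    exact Nat.zero_le _

/-! ### Thm. 10.1 from Thm. 10.3: one exponent `n` at a time, `2 ≤ n ≤ 8` (p. 34) -/

/-- **(EqValN) for the level of a parametrisation datum: `v_p(N') ≤ 8`** (p. 33: "Since the
conductor of the elliptic curve `A` is `N`, we know that in the relevant cases `v_p(N) ≤ 8`
(`p = 2`), `5` (`p = 3`), `2` (`p ≥ 5`)"). The level is the conductor by Carayol's theorem (the
named fact `IsNewformOf.level_eq_conductorNorm`, hypothesis `hCar`), and `f_p ≤ 8` over `ℚ` is the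
tree's `conductorExponent_le_eight_holds` (read on `N_E` through `factorization_conductorNorm_holds`).
[cite: PastenShimura2024, §10.1 (EqValN) p. 33] -/
theorem factorization_level_le_eight
    (hCar : ∀ {N' : ℕ} [NeZero N'], IsNewformOf.level_eq_conductorNorm (N := N'))
    {W' : WeierstrassCurve ℚ} [W'.IsElliptic] {N' : ℕ} [NeZero N']
    (D' : ModularParametrizationData W' N') (p : ℕ) : N'.factorization p ≤ 8 := by
  by_cases hp : p.Prime
  · have hN : N' = W'.conductorNorm ℤ := hCar D'.isNewformOf
    have hgen : Rat.HeightOneSpectrum.natGenerator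
        ((Rat.HeightOneSpectrum.primesEquiv (R := ℤ)).symm ⟨p, hp⟩) = p :=
      congrArg Subtype.val
        ((Rat.HeightOneSpectrum.primesEquiv (R := ℤ)).apply_symm_apply ⟨p, hp⟩)
    have hf : (W'.conductorNorm ℤ).factorization (Rat.HeightOneSpectrum.natGenerator
        ((Rat.HeightOneSpectrum.primesEquiv (R := ℤ)).symm ⟨p, hp⟩)) = W'.conductorExponent
          ((Rat.HeightOneSpectrum.primesEquiv (R := ℤ)).symm ⟨p, hp⟩) :=
      W'.factorization_conductorNorm_holds _
    rw [hgen] at hf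
    rw [hN, hf]
    exact W'.conductorExponent_le_eight_holds _
  · exact (Nat.factorization_eq_zero_of_not_prime _ hp).trans_le (Nat.zero_le _)

/-- **Thm. 10.1, additive case, from Thm. 10.3** (p. 34: "Theorem (ThmManinCt) will follow by
fixing the choice `ℓ = 5` unless `p = 5` in which case we take `ℓ = 7`, and from the fact that
`n ≤ 8` by (EqValN)"). The input `h103` is Thm. 10.3 in lattice form: for fixed `S`, `p` and
`2 ≤ n ≤ 8` there is `𝓑 = 𝓑(S, p, n)` with `v_p(c) ≤ 𝓑` for every optimal datum (`Λ_{E'} ⊆ c Λ_f`)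
on a globally minimal model at a level `N'` with `v_p(N') = n` (i.e. `N' = pⁿm`, `p ∤ m`) that is
squarefree away from `S` (the printed "`m` squarefree away from `S`"; with `n ≥ 2` this forces
`p ∈ S`, p. 34). Then `μ_{S,p} := max_{2 ≤ n ≤ 8} 𝓑(S, p, n)` serves at every level divisible by
`p²`, because `2 ≤ v_p(N') ≤ 8` (`factorization_level_le_eight`, using Carayol's fact `hCar`).
[cite: PastenShimura2024, Thm. 10.3 and §10.2 p. 34 (reduction of Thm. 10.1 to Thm. 10.3)] -/
theorem PastenShimura2024_thm_10_1_additive_of_thm_10_3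
    (h103 : ∀ (S : Finset ℕ) (p : ℕ), p.Prime → ∀ n : ℕ, 2 ≤ n → n ≤ 8 → ∃ 𝓑 : ℕ,
      ∀ (W' : WeierstrassCurve ℚ) [W'.IsElliptic] [W'.IsGloballyMinimal] {N' : ℕ} [NeZero N']
        (D' : ModularParametrizationData W' N'),
        (∀ z ∈ D'.L.lattice, ∃ w ∈ periodLattice D'.f, z = D'.c * w) →
        N'.factorization p = n → (∀ q : ℕ, q.Prime → q ∉ S → ¬ q ^ 2 ∣ N') →
        padicValInt p D'.maninConstant ≤ 𝓑)
    (hCar : ∀ {N' : ℕ} [NeZero N'], IsNewformOf.level_eq_conductorNorm (N := N'))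
    (S : Finset ℕ) (p : ℕ) (hp : p.Prime) : ∃ μ : ℕ,
      ∀ (W' : WeierstrassCurve ℚ) [W'.IsElliptic] [W'.IsGloballyMinimal] {N' : ℕ} [NeZero N']
        (D' : ModularParametrizationData W' N'),
        (∀ z ∈ D'.L.lattice, ∃ w ∈ periodLattice D'.f, z = D'.c * w) →
        p ^ 2 ∣ N' → (∀ q : ℕ, q.Prime → q ∉ S → ¬ q ^ 2 ∣ N') →
        padicValInt p D'.maninConstant ≤ μ := by
  classical
  -- one bound `𝓑 n` per exponent `n ∈ [2, 8]` (and `0` elsewhere), then their maximum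
  have hB : ∀ n : ℕ, ∃ 𝓑 : ℕ, 2 ≤ n → n ≤ 8 →
      ∀ (W' : WeierstrassCurve ℚ) [W'.IsElliptic] [W'.IsGloballyMinimal] {N' : ℕ} [NeZero N']
        (D' : ModularParametrizationData W' N'),
        (∀ z ∈ D'.L.lattice, ∃ w ∈ periodLattice D'.f, z = D'.c * w) →
        N'.factorization p = n → (∀ q : ℕ, q.Prime → q ∉ S → ¬ q ^ 2 ∣ N') →
        padicValInt p D'.maninConstant ≤ 𝓑 := by
    intro n
    by_cases hn : 2 ≤ n ∧ n ≤ 8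
    · obtain ⟨𝓑, h𝓑⟩ := h103 S p hp n hn.1 hn.2
      exact ⟨𝓑, fun _ _ ↦ h𝓑⟩
    · exact ⟨0, fun h2 h8 ↦ absurd ⟨h2, h8⟩ hn⟩
  choose 𝓑 h𝓑 using hB
  refine ⟨(Finset.range 9).sup 𝓑, fun W' _ _ N' _ D' hlat hpN hsq ↦ ?_⟩
  have h2 : 2 ≤ N'.factorization p := (hp.pow_dvd_iff_le_factorization (NeZero.ne N')).mp hpN
  have h8 : N'.factorization p ≤ 8 := factorization_level_le_eight hCar D' p
  exact (h𝓑 _ h2 h8 W' D' hlat rfl hsq).trans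
    (Finset.le_sup (f := 𝓑) (Finset.mem_range.mpr (by omega)))

/-- **The fact gives back Thm. 10.3 (lattice form)** — for every `S`, prime `p` and `n ≥ 2`, a
bound for `v_p(c)` over optimal data at levels `N'` with `v_p(N') = n`, squarefree away from `S`:
a restriction of `PastenShimura2024_thm_10_1_additive_latticeForm_of_cor_10_2` (`v_p(N') = n ≥ 2`
gives `p² ∣ N'`). [cite: PastenShimura2024, Cor. 10.2 p. 33 and Thm. 10.3 p. 34] -/
theorem PastenShimura2024_thm_10_3_of_cor_10_2 (h : PastenShimura2024_cor_10_2) (S : Finset ℕ)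
    (p : ℕ) (hp : p.Prime) (n : ℕ) (hn : 2 ≤ n) : ∃ 𝓑 : ℕ,
      ∀ (W' : WeierstrassCurve ℚ) [W'.IsElliptic] [W'.IsGloballyMinimal] {N' : ℕ} [NeZero N']
        (D' : ModularParametrizationData W' N'),
        (∀ z ∈ D'.L.lattice, ∃ w ∈ periodLattice D'.f, z = D'.c * w) →
        N'.factorization p = n → (∀ q : ℕ, q.Prime → q ∉ S → ¬ q ^ 2 ∣ N') →
        padicValInt p D'.maninConstant ≤ 𝓑 := by
  obtain ⟨μ, hμ⟩ := PastenShimura2024_thm_10_1_additive_latticeForm_of_cor_10_2 h S p hp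
  refine ⟨μ, fun W' _ _ N' _ D' hlat hfac hsq ↦ hμ W' D' hlat ?_ hsq⟩
  exact (hp.pow_dvd_iff_le_factorization (NeZero.ne N')).mpr (by omega)

/-- **Cor. 10.2 from Thm. 10.3 and the four classical facts** (Carayol: level = conductor;
Mazur 1978, Cor. 4.1; Abbes–Ullmo 1996, Thm. A; Česnavičius 2018, Thm. 1.2): the printed proof of
Cor. 10.2 with Thm. 10.1 opened up two steps — `n ≤ 1` is the existing literature, `2 ≤ n ≤ 8` is
Thm. 10.3, `n ≥ 9` does not occur by (EqValN). What remains open behind `h103` is the geometry of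
§§10.3–10.6 (integral models of `X_{U₀(pⁿm) ∩ U₁(ℓ)}`, Néron models, Thm. 10.4, Ihara's lemma,
[ARSdeg]); its commutative algebra is `ShimuraCurveRibetTakahashiManinValuationProofs.lean`.
[cite: PastenShimura2024, Cor. 10.2, Thm. 10.1 p. 33 and Thm. 10.3 p. 34] [cite: Mazur1978, Cor. 4.1] [cite: AbbesUllmo1996, Thm. A] [cite: Cesnavicius2018, Thm. 1.2] -/
theorem PastenShimura2024_cor_10_2_of_thm_10_3
    (h103 : ∀ (S : Finset ℕ) (p : ℕ), p.Prime → ∀ n : ℕ, 2 ≤ n → n ≤ 8 → ∃ 𝓑 : ℕ,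
      ∀ (W' : WeierstrassCurve ℚ) [W'.IsElliptic] [W'.IsGloballyMinimal] {N' : ℕ} [NeZero N']
        (D' : ModularParametrizationData W' N'),
        (∀ z ∈ D'.L.lattice, ∃ w ∈ periodLattice D'.f, z = D'.c * w) →
        N'.factorization p = n → (∀ q : ℕ, q.Prime → q ∉ S → ¬ q ^ 2 ∣ N') →
        padicValInt p D'.maninConstant ≤ 𝓑)
    (hCar : ∀ {N' : ℕ} [NeZero N'], IsNewformOf.level_eq_conductorNorm (N := N'))
    (hM : mazur_not_dvd_maninConstant_of_odd)
    (hAU : abbesUllmo_not_dvd_maninConstant_of_not_dvd_level)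
    (hC : cesnavicius_not_two_dvd_maninConstant_of_two_dvd_level) :
    PastenShimura2024_cor_10_2 :=
  PastenShimura2024_cor_10_2_of_thm_10_1_additive
    (PastenShimura2024_thm_10_1_additive_of_thm_10_3 h103 hCar) hM hAU hC

/-- **Modulo Carayol's and the three prime-by-prime facts, `PastenShimura2024_cor_10_2` is
equivalent to Thm. 10.3** (lattice form, `2 ≤ n ≤ 8`): the open content of the fact beyond the
classical named facts of the tree is exactly Pasten's Thm. 10.3, i.e. §§10.2–10.6.
[cite: PastenShimura2024, Cor. 10.2 p. 33 and Thm. 10.3 p. 34] -/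
theorem PastenShimura2024_cor_10_2_iff_thm_10_3
    (hCar : ∀ {N' : ℕ} [NeZero N'], IsNewformOf.level_eq_conductorNorm (N := N'))
    (hM : mazur_not_dvd_maninConstant_of_odd)
    (hAU : abbesUllmo_not_dvd_maninConstant_of_not_dvd_level)
    (hC : cesnavicius_not_two_dvd_maninConstant_of_two_dvd_level) :
    PastenShimura2024_cor_10_2 ↔
    ∀ (S : Finset ℕ) (p : ℕ), p.Prime → ∀ n : ℕ, 2 ≤ n → n ≤ 8 → ∃ 𝓑 : ℕ,
      ∀ (W' : WeierstrassCurve ℚ) [W'.IsElliptic] [W'.IsGloballyMinimal] {N' : ℕ} [NeZero N']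
        (D' : ModularParametrizationData W' N'),
        (∀ z ∈ D'.L.lattice, ∃ w ∈ periodLattice D'.f, z = D'.c * w) →
        N'.factorization p = n → (∀ q : ℕ, q.Prime → q ∉ S → ¬ q ^ 2 ∣ N') →
        padicValInt p D'.maninConstant ≤ 𝓑 :=
  ⟨fun h S p hp n hn _ ↦ PastenShimura2024_thm_10_3_of_cor_10_2 h S p hp n hn,
    fun h103 ↦ PastenShimura2024_cor_10_2_of_thm_10_3 h103 hCar hM hAU hC⟩

end Literature.NumberTheory.Automorphic

end
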